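/-
COR-CM (cell pub-hodgecm2, stage 2 of the Hodge ladder) — count-neutral KERNEL COMBINATORICS «order 16: the quaternion doublings», part Xa: a QUATERNION PAIR and its
subgroup `⟨i, j⟩ ≅ Q₈`, from the five relations alone (seat prover-pub-hodgecm2-b23-g54-0, binder prover b23, gen 54; claim HOME/INBOX.md l.25095).  Theorems only
(pure group theory; part IIb proves the same facts inside a datum — here no involution `x` is available yet); no `decide` beyond closed identities in `ℕ`, no
certificate, no named fact, no `sorry`.  `Interfaces.lean` (C1), every E term, B01, `Transposition/*`, `PortJoin/*`, `D2Bridge/*` untouched.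
HONEST FRAMING: `HC_CM` is NOT proved, here or anywhere in the tree; nothing here is a period, a count of record or a headline.
T5: n/a-class (hypothesis binders: `orderOf i = 4`, `i² = j² = c`, `j i j⁻¹ = i⁻¹`, `j ∉ ⟨i⟩`; inhabited by `Q₈`); checker: self.
-/
import Summits.HodgeConjecture.CorCM.Census.QuaternionDoublingDatum

/-!
# The quaternion doublings, Xa: a quaternion pair

For `i, j` in a group with `i` of order `4`, `i² = j² = c`, `j i j⁻¹ = i⁻¹`, `j ∉ ⟨i⟩`: the relations (`c² = 1`, `c ≠ 1`, `j i = c i j`, `i j i⁻¹ = c j`),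
**`⟨i, j⟩ = {iᵘ jᵛ : u < 4, v < 2}`** (`qp_mem_closure_iff`), **`|⟨i, j⟩| = 8`** (`qp_card_closure`), and the SQUARES: `(iᵘ jᵛ)² = c` unless the word is `1` or `c`
(`qp_sq_word`), so every other word has order `4` (`qp_orderOf_eq_four`).  Part X dispatches every group of order `16` containing such a pair.  All [folklore].

## References
* [Pohlmann1968] H. Pohlmann, Algebraic cycles on abelian varieties of complex multiplication type, Ann. of Math. 88 (1968), Thm 1.
-/

namespace Summit.HodgeConjecture.CorCM.Census.QuaternionDoubling

open Finset

noncomputable section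

variable {G : Type*} [Group G] [Fintype G] [DecidableEq G] {c i j : G}

/-! ## §1 A quaternion pair and its subgroup `Q = ⟨i, j⟩` -/

section Pair

variable (hord : orderOf i = 4) (hii : i * i = c) (hjj : j * j = c) (hji : j * i * j⁻¹ = i⁻¹) (hj : j ∉ Subgroup.zpowers i)

omit [Fintype G] [DecidableEq G] in
include hord in
/-- `i⁴ = 1`. [folklore] -/
theorem qp_i_pow_four : i ^ 4 = 1 := by rw [← hord, pow_orderOf_eq_one]

omit [Fintype G] [DecidableEq G] in
include hord hii in
/-- `c² = 1`. [folklore] -/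
theorem qp_c_mul_c : c * c = 1 := by
  rw [← hii, show i * i * (i * i) = i ^ 4 by simp only [pow_succ, pow_zero, one_mul, mul_assoc], qp_i_pow_four hord]

omit [Fintype G] [DecidableEq G] in
include hord hii in
/-- `c ≠ 1`. [folklore] -/
theorem qp_c_ne_one : c ≠ 1 := by
  intro h
  have h2 : i ^ 2 = 1 := by rw [pow_two, hii, h]
  have := orderOf_dvd_of_pow_eq_one h2
  rw [hord] at this
  omega

omit [Fintype G] [DecidableEq G] in
include hord hii in
/-- `i⁻¹ = c i = i³`. [folklore] -/
theorem qp_i_inv : i⁻¹ = c * i := by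
  apply inv_eq_of_mul_eq_one_right
  calc i * (c * i) = i * (i * i * i) := by rw [hii]
    _ = i ^ 4 := by simp only [pow_succ, pow_zero, one_mul, mul_assoc]
    _ = 1 := qp_i_pow_four hord

omit [Fintype G] [DecidableEq G] in
include hord hii hjj in
/-- `j⁻¹ = c j`. [folklore] -/
theorem qp_j_inv : j⁻¹ = c * j := by
  apply inv_eq_of_mul_eq_one_right
  calc j * (c * j) = j * (j * j * j) := by rw [hjj]
    _ = (j * j) * (j * j) := by group
    _ = 1 := by rw [hjj, qp_c_mul_c hord hii]

omit [Fintype G] [DecidableEq G] in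
include hord hii hji in
/-- `j i = c i j`. [folklore] -/
theorem qp_j_mul_i : j * i = c * i * j := by
  calc j * i = j * i * j⁻¹ * j := by rw [inv_mul_cancel_right]
    _ = c * i * j := by rw [hji, qp_i_inv hord hii]

omit [Fintype G] [DecidableEq G] in
include hii in
/-- `i` commutes with `c`. [folklore] -/
theorem qp_commute_i_c : Commute i c := by
  show i * c = c * i
  calc i * c = i * (i * i) := by rw [hii]
    _ = (i * i) * i := by group
    _ = c * i := by rw [hii]

omit [Fintype G] [DecidableEq G] in
include hjj in
/-- `j` commutes with `c`. [folklore] -/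
theorem qp_commute_j_c : Commute j c := by
  show j * c = c * j
  calc j * c = j * (j * j) := by rw [hjj]
    _ = (j * j) * j := by group
    _ = c * j := by rw [hjj]

omit [Fintype G] [DecidableEq G] in
include hord hii hji in
/-- `iᵘ j = j i^{3u}`. [folklore] -/
theorem qp_i_pow_mul_j (u : ℕ) : i ^ u * j = j * i ^ (3 * u) := by
  have h3 : i ^ 3 = i⁻¹ := by rw [qp_i_inv hord hii, pow_succ, pow_two, hii]
  have h0 : j * (i⁻¹ * j⁻¹) = i := by
    have := congrArg (·⁻¹) hji
    simpa only [mul_inv_rev, inv_inv] using this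
  have h1 : i * j = j * i ^ 3 := by
    calc i * j = j * (i⁻¹ * j⁻¹) * j := by rw [h0]
      _ = j * i⁻¹ := by group
      _ = j * i ^ 3 := by rw [h3]
  induction u with
  | zero => simp
  | succ u ih =>
    calc i ^ (u + 1) * j = i ^ u * (i * j) := by rw [pow_succ]; group
      _ = i ^ u * j * i ^ 3 := by rw [h1]; group
      _ = j * i ^ (3 * u) * i ^ 3 := by rw [ih]
      _ = j * i ^ (3 * (u + 1)) := by rw [mul_assoc, ← pow_add, show 3 * u + 3 = 3 * (u + 1) by ring]

omit [Fintype G] [DecidableEq G] in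
include hord in
/-- Reduction of exponents of `i` modulo `4`. [folklore] -/
theorem qp_i_pow_mod (u : ℕ) : i ^ u = i ^ (u % 4) := by
  conv_lhs => rw [← Nat.mod_add_div u 4, pow_add, pow_mul, qp_i_pow_four hord, one_pow, mul_one]

omit [Fintype G] [DecidableEq G] in
include hord hii hjj hji in
/-- **`⟨i, j⟩ = {iᵘ jᵛ : u < 4, v < 2}`.** [folklore] -/
theorem qp_mem_closure_iff (g : G) : g ∈ Subgroup.closure {i, j} ↔ ∃ u : ℕ, u < 4 ∧ ∃ v : ℕ, v < 2 ∧ g = i ^ u * j ^ v := by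
  have hi : ∀ u v : ℕ, v < 2 → ∃ u' : ℕ, u' < 4 ∧ ∃ v' : ℕ, v' < 2 ∧ i ^ u * j ^ v * i = i ^ u' * j ^ v' := by
    intro u v hv
    interval_cases v
    · refine ⟨(u + 1) % 4, Nat.mod_lt _ (by norm_num), 0, by norm_num, ?_⟩
      simp only [pow_zero, mul_one]
      rw [← pow_succ, ← qp_i_pow_mod hord]
    · refine ⟨(u + 3) % 4, Nat.mod_lt _ (by norm_num), 1, by norm_num, ?_⟩
      have hji1 : j * i = i ^ 3 * j := by
        have h := qp_i_pow_mul_j hord hii hji 3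
        rw [show 3 * 3 = 4 * 2 + 1 by norm_num, pow_add, pow_mul, qp_i_pow_four hord, one_pow, one_mul, pow_one] at h
        exact h.symm
      simp only [pow_one]
      rw [mul_assoc, hji1, ← mul_assoc, ← pow_add, ← qp_i_pow_mod hord]
  have hj' : ∀ u v : ℕ, v < 2 → ∃ u' : ℕ, u' < 4 ∧ ∃ v' : ℕ, v' < 2 ∧ i ^ u * j ^ v * j = i ^ u' * j ^ v' := by
    intro u v hv
    interval_cases v
    · refine ⟨u % 4, Nat.mod_lt _ (by norm_num), 1, by norm_num, ?_⟩
      simp only [pow_zero, mul_one, pow_one]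
      rw [← qp_i_pow_mod hord]
    · refine ⟨(u + 2) % 4, Nat.mod_lt _ (by norm_num), 0, by norm_num, ?_⟩
      simp only [pow_one, pow_zero, mul_one]
      rw [mul_assoc, hjj, ← qp_i_pow_mod hord, pow_add, pow_two, hii]
  have hgen : ∀ (u v : ℕ), v < 2 → ∀ y : G, (y = i ∨ y = j ∨ y = i⁻¹ ∨ y = j⁻¹) →
      ∃ u' : ℕ, u' < 4 ∧ ∃ v' : ℕ, v' < 2 ∧ i ^ u * j ^ v * y = i ^ u' * j ^ v' := by
    intro u v hv y hy
    rcases hy with rfl | rfl | rfl | rfl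
    · exact hi u v hv
    · exact hj' u v hv
    · rw [show i⁻¹ = i * i * i by rw [qp_i_inv hord hii, hii]]
      obtain ⟨u₁, hu₁, v₁, hv₁, h₁⟩ := hi u v hv
      obtain ⟨u₂, hu₂, v₂, hv₂, h₂⟩ := hi u₁ v₁ hv₁
      obtain ⟨u₃, hu₃, v₃, hv₃, h₃⟩ := hi u₂ v₂ hv₂
      exact ⟨u₃, hu₃, v₃, hv₃, by rw [← mul_assoc, ← mul_assoc, h₁, h₂, h₃]⟩
    · rw [show j⁻¹ = j * j * j by rw [qp_j_inv hord hii hjj, hjj]]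
      obtain ⟨u₁, hu₁, v₁, hv₁, h₁⟩ := hj' u v hv
      obtain ⟨u₂, hu₂, v₂, hv₂, h₂⟩ := hj' u₁ v₁ hv₁
      obtain ⟨u₃, hu₃, v₃, hv₃, h₃⟩ := hj' u₂ v₂ hv₂
      exact ⟨u₃, hu₃, v₃, hv₃, by rw [← mul_assoc, ← mul_assoc, h₁, h₂, h₃]⟩
  constructor
  · intro hg
    refine Subgroup.closure_induction_right (p := fun g _ => ∃ u : ℕ, u < 4 ∧ ∃ v : ℕ, v < 2 ∧ g = i ^ u * j ^ v)
      ⟨0, by norm_num, 0, by norm_num, by simp⟩ ?_ ?_ hg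
    · rintro g - y hy ⟨u, hu, v, hv, rfl⟩
      have hy' : y = i ∨ y = j ∨ y = i⁻¹ ∨ y = j⁻¹ := by
        rcases hy with rfl | hy
        · exact Or.inl rfl
        · exact Or.inr (Or.inl (Set.mem_singleton_iff.mp hy))
      exact hgen u v hv y hy'
    · rintro g - y hy ⟨u, hu, v, hv, rfl⟩
      have hy' : y⁻¹ = i ∨ y⁻¹ = j ∨ y⁻¹ = i⁻¹ ∨ y⁻¹ = j⁻¹ := by
        rcases hy with rfl | hy
        · exact Or.inr (Or.inr (Or.inl rfl))
        · exact Or.inr (Or.inr (Or.inr (by rw [Set.mem_singleton_iff.mp hy])))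
      exact hgen u v hv y⁻¹ hy'
  · rintro ⟨u, -, v, -, rfl⟩
    have hiQ : i ∈ Subgroup.closure ({i, j} : Set G) := Subgroup.subset_closure (Set.mem_insert _ _)
    have hjQ : j ∈ Subgroup.closure ({i, j} : Set G) := Subgroup.subset_closure (Set.mem_insert_of_mem _ rfl)
    exact (Subgroup.closure ({i, j} : Set G)).mul_mem ((Subgroup.closure ({i, j} : Set G)).pow_mem hiQ u)
      ((Subgroup.closure ({i, j} : Set G)).pow_mem hjQ v)

omit [Fintype G] [DecidableEq G] in
include hord hj in
/-- The words `iᵘ jᵛ` (`u < 4`, `v < 2`) are distinct. [folklore] -/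
private theorem qp_word_inj {u v u' v' : ℕ} (hu : u < 4) (hu' : u' < 4) (hv : v < 2) (hv' : v' < 2)
    (h : i ^ u * j ^ v = i ^ u' * j ^ v') : u = u' ∧ v = v' := by
  have hvv : v = v' := by
    by_contra hne
    have key : ∀ {a b : ℕ}, i ^ a * j = i ^ b → False := fun {a b} hab =>
      hj (by
        have : j = (i ^ a)⁻¹ * i ^ b := by rw [← hab, inv_mul_cancel_left]
        rw [this]
        exact mul_mem (inv_mem (Subgroup.pow_mem _ (Subgroup.mem_zpowers _) _)) (Subgroup.pow_mem _ (Subgroup.mem_zpowers _) _))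
    interval_cases v <;> interval_cases v'
    · exact hne rfl
    · rw [pow_zero, mul_one, pow_one] at h; exact key h.symm
    · rw [pow_zero, mul_one, pow_one] at h; exact key h
    · exact hne rfl
  subst hvv
  refine ⟨?_, rfl⟩
  have h' : i ^ u = i ^ u' := mul_right_cancel h
  have := pow_inj_mod.mp h'
  rwa [hord, Nat.mod_eq_of_lt hu, Nat.mod_eq_of_lt hu'] at this

omit [Fintype G] [DecidableEq G] in
include hord hii hjj hji hj in
/-- **`|⟨i, j⟩| = 8`.** [folklore] -/
theorem qp_card_closure : Nat.card (Subgroup.closure ({i, j} : Set G)) = 8 := by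
  classical
  let f : Fin 4 × Fin 2 → Subgroup.closure ({i, j} : Set G) := fun t =>
    ⟨i ^ (t.1 : ℕ) * j ^ (t.2 : ℕ), (qp_mem_closure_iff hord hii hjj hji _).mpr ⟨t.1, t.1.2, t.2, t.2.2, rfl⟩⟩
  have hinj : Function.Injective f := by
    rintro ⟨u, v⟩ ⟨u', v'⟩ h
    obtain ⟨h1, h2⟩ := qp_word_inj hord hj u.2 u'.2 v.2 v'.2 (congrArg Subtype.val h)
    ext <;> simp only [h1, h2]
  have hsurj : Function.Surjective f := by
    rintro ⟨g, hg⟩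
    obtain ⟨u, hu, v, hv, rfl⟩ := (qp_mem_closure_iff hord hii hjj hji g).mp hg
    exact ⟨(⟨u, hu⟩, ⟨v, hv⟩), rfl⟩
  rw [← Nat.card_eq_of_bijective f ⟨hinj, hsurj⟩]
  simp

omit [Fintype G] [DecidableEq G] in
include hord hii hjj hji in
/-- **Squares in `Q`**: `(iᵘ jᵛ)² = 1` forces `iᵘ jᵛ ∈ {1, c}`; every other word squares to `c`. [folklore] -/
theorem qp_sq_word (u v : ℕ) (hv : v < 2) : (i ^ u * j ^ v) * (i ^ u * j ^ v) = c ∨ (v = 0 ∧ i ^ u * j ^ v * (i ^ u * j ^ v) = 1 ∧ (i ^ u = 1 ∨ i ^ u = c)) := by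
  interval_cases v
  · -- `(iᵘ)² = cᵘ`
    rw [pow_zero, mul_one]
    rw [qp_i_pow_mod hord u]
    have hu := Nat.mod_lt u (show 0 < 4 by norm_num)
    interval_cases hm : u % 4
    · right; simp
    · left; rw [pow_one, hii]
    · right; refine ⟨rfl, ?_, Or.inr (by rw [pow_two, hii])⟩
      rw [pow_two, hii, qp_c_mul_c hord hii]
    · left
      rw [show i ^ 3 * i ^ 3 = i ^ 4 * (i * i) by simp only [pow_succ, pow_zero, one_mul, mul_assoc], qp_i_pow_four hord, one_mul, hii]
  · left
    rw [pow_one, show i ^ u * j * (i ^ u * j) = i ^ u * (j * i ^ u) * j by group]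
    have hjiu : j * i ^ u = i ^ (3 * u) * j := by
      have h := qp_i_pow_mul_j hord hii hji (3 * u)
      rw [show 3 * (3 * u) = 4 * (2 * u) + u by ring, pow_add, show i ^ (4 * (2 * u)) = 1 by
        rw [pow_mul, qp_i_pow_four hord, one_pow], one_mul] at h
      exact h.symm
    rw [hjiu, show i ^ u * (i ^ (3 * u) * j) * j = i ^ (u + 3 * u) * (j * j) by rw [pow_add]; group, hjj,
      show u + 3 * u = 4 * u by ring, pow_mul, qp_i_pow_four hord, one_pow, one_mul]

omit [Fintype G] [DecidableEq G] in
include hord hii hjj hji in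
/-- An element `q` of `Q` with `q² = 1`... more usefully: **every word `iᵘ j` and every odd power `i^{2m+1}` has order `4`.** [folklore] -/
theorem qp_orderOf_eq_four {u v : ℕ} (hv : v < 2) (h : ¬ (v = 0 ∧ (i ^ u = 1 ∨ i ^ u = c))) : orderOf (i ^ u * j ^ v) = 4 := by
  have hsq : (i ^ u * j ^ v) * (i ^ u * j ^ v) = c := by
    rcases qp_sq_word hord hii hjj hji u v hv with h1 | ⟨hv0, -, h2⟩
    · exact h1
    · exact absurd ⟨hv0, h2⟩ h
  haveI : Fact (Nat.Prime 2) := ⟨Nat.prime_two⟩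
  have h := orderOf_eq_prime_pow (p := 2) (n := 1) (x := i ^ u * j ^ v) (by rw [pow_one, pow_two, hsq]; exact qp_c_ne_one hord hii)
    (by rw [show 2 ^ (1 + 1) = 2 * 2 by norm_num, pow_mul, pow_two (i ^ u * j ^ v), hsq, pow_two, qp_c_mul_c hord hii])
  simpa using h

omit [Fintype G] [DecidableEq G] in
include hord hii hjj hji in
/-- `i j i⁻¹ = c j`. [folklore] -/
theorem qp_i_mul_j_mul_i_inv : i * j * i⁻¹ = c * j := by
  rw [qp_i_inv hord hii]
  calc i * j * (c * i) = i * (j * c) * i := by group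
    _ = i * (c * j) * i := by rw [(qp_commute_j_c hjj).eq]
    _ = c * (i * (j * i)) := by rw [show i * (c * j) * i = (i * c) * (j * i) by group, (qp_commute_i_c hii).eq]; group
    _ = c * (i * (c * i * j)) := by rw [qp_j_mul_i hord hii hji]
    _ = c * (i * c) * i * j := by group
    _ = c * (c * i) * i * j := by rw [(qp_commute_i_c hii).eq]
    _ = (c * c) * (i * i) * j := by group
    _ = c * j := by rw [qp_c_mul_c hord hii, one_mul, hii]

end Pair

end

end Summit.HodgeConjecture.CorCM.Census.QuaternionDoubling
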